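import Literature.MathematicalPhysics.KineticTheory.SerrePeriodicPayloadProofs
import HarnessLib

/-!
# Serre's periodic payload bound: the optimisation over the node weights

Second elementary reduction step of D. Serre's collision estimate for hard spheres in a periodic
box (Serre 2024, Thm. 6; §5 pp. 1438–1440), continuing
`Literature.MathematicalPhysics.KineticTheory.SerrePeriodicPayloadProofs`
(`serrePeriodicPayloadBound_of_inhomogeneous`: Serre's inhomogeneous inequality (18) implies the
named fact `SerrePeriodicPayloadBound` by time dilation and absorption).

Compensated Integrability with determinantal masses (Serre 2024 Thm. 11, (14)) applied to the
mass–momentum tensor of the billiard augmented by the correctors `b_X S_X` at the nodes `X` of the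
particle graph gives, once the determinantal masses (15), the divergence (16) and the trace (17)
are plugged in (p. 1439, the display before (18), `d = 3`):

`Σ_nodes b_X^{2/3} |[v]_X|^{1/3} ≤_d (N + √(N E) + E T + a Σ_nodes |[v]| + Σ_nodes b_X)^{4/3}`

for ALL choices of positive weights `b_X`. Serre then "relaxes the parameters `b_X`" and uses the
`ℓ³`–`ℓ^{3/2}` duality to reach (18): `Σ|[v]| ≤_d (N + √(NE) + ET + aΣ|[v]|)²`. This file proves
that step in the tree's vocabulary (nodes = pairs `(t, i)` of a collision time of the window and a
particle, `|[v]_X| = ‖v_i(t) − v_i(t⁻)‖`, so that `Σ_nodes |[v]_X|` is the `collisionPayload`):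

* `inhomogeneous_of_nodeWeights` — the weighted node inequality for all nonnegative weight
  families `w : ℝ → Fin K → ℝ` implies Serre's (18) with constant `16 max(C,0)³` (choose
  `w = κ |[v]|` with `κ = R / pay`, `R = K + √(KE) + (b−a)E + ε·pay`, and cube);
* `serrePeriodicPayloadBound_of_nodeWeights` — hence it implies `SerrePeriodicPayloadBound`.

What remains for `SerrePeriodicPayloadBound_holds` after this file is exactly the hypothesis
`h14` below: Theorem 11 of Serre 2024 for the corrected billiard tensor together with the
bookkeeping (15)–(17) — the compensated-integrability core, not in Mathlib.

## References

* D. Serre, *Compensated integrability on tori; a priori estimate for space-periodic gas flows*,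
  C. R. Math. Acad. Sci. Paris 362 (2024) 1425–1444, doi:10.5802/crmath.654, §5 pp. 1438–1440,
  (14)–(18). [Serre2024]
-/

noncomputable section

open Set Function

namespace Literature.MathematicalPhysics.KineticTheory

open Literature.Analysis.FluidPDE

/-- **Optimisation over the node weights** (Serre 2024 §5 p. 1439, the passage from the display
before (18) to (18), `d = 3`). If for every hard-sphere trajectory on `𝕋³`, every window `[a, b]`
and every family of nonnegative node weights `w (t, i)` one has
`Σ_{t ∈ C ∩ [a,b]} Σ_i w(t,i)^{2/3} ‖v_i(t) − v_i(t⁻)‖^{1/3}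
   ≤ C (K + √(K E) + (b − a) E + ε·pay + Σ_{t} Σ_i w(t,i))^{4/3}`
(the output of compensated integrability with determinantal masses, (14) with (15)–(17)), then
Serre's inhomogeneous inequality (18) holds: `pay ≤ 16 max(C,0)³ (K + √(KE) + (b−a)E + ε·pay)²`.
Proof: with `R = K + √(KE) + (b−a)E + ε·pay` and `pay > 0`, take `w = (R / pay) · |[v]|`; the
left side is `(R/pay)^{2/3} pay`, the right side `C (2R)^{4/3}`; cube and divide by `R²`.
[cite: Serre2024, §5 p. 1439, (14)–(18)] -/
theorem inhomogeneous_of_nodeWeights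
    (h14 : ∃ C : ℝ, ∀ (K : ℕ) (ε : ℝ), 0 < ε →
      ∀ γ : ℝ → Config K (Fin 3) T3, IsHardSphereTrajectory (Torus.geometry (Fin 3)) ε K γ →
        ∀ a b : ℝ, a ≤ b → ∀ w : ℝ → Fin K → ℝ, (∀ t i, 0 ≤ w t i) →
          (∑ᶠ t ∈ collisionTimes (Torus.geometry (Fin 3)) ε γ ∩ Icc a b,
              ∑ i, w t i ^ ((2 : ℝ) / 3) * ‖(γ t i).2 - (leftLim γ t i).2‖ ^ ((1 : ℝ) / 3)) ≤
            C * ((K : ℝ) + Real.sqrt ((K : ℝ) * configEnergy (γ a)) +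
              (b - a) * configEnergy (γ a) +
              ε * collisionPayload (Torus.geometry (Fin 3)) ε γ a b +
              ∑ᶠ t ∈ collisionTimes (Torus.geometry (Fin 3)) ε γ ∩ Icc a b, ∑ i, w t i) ^
                ((4 : ℝ) / 3)) :
    ∃ C : ℝ, ∀ (K : ℕ) (ε : ℝ), 0 < ε →
      ∀ γ : ℝ → Config K (Fin 3) T3, IsHardSphereTrajectory (Torus.geometry (Fin 3)) ε K γ →
        ∀ a b : ℝ, a ≤ b →
          collisionPayload (Torus.geometry (Fin 3)) ε γ a b ≤
            C * ((K : ℝ) + Real.sqrt ((K : ℝ) * configEnergy (γ a)) +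
              (b - a) * configEnergy (γ a) +
              ε * collisionPayload (Torus.geometry (Fin 3)) ε γ a b) ^ 2 := by
  obtain ⟨C, hC⟩ := h14
  refine ⟨16 * (max C 0) ^ 3, fun K ε hε γ hγ a b hab => ?_⟩
  set G := Torus.geometry (Fin 3) with hG
  set P : ℝ := collisionPayload G ε γ a b with hP
  set E : ℝ := configEnergy (γ a) with hE
  have hP0 : 0 ≤ P := collisionPayload_nonneg G ε γ a b
  have hE0 : 0 ≤ E := by
    rw [hE]
    unfold configEnergy
    positivity
  have hT0 : 0 ≤ b - a := sub_nonneg.2 hab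
  set R : ℝ := (K : ℝ) + Real.sqrt ((K : ℝ) * E) + (b - a) * E + ε * P with hR
  have hR0 : 0 ≤ R := by positivity
  have hRHS0 : 0 ≤ 16 * (max C 0) ^ 3 * R ^ 2 := by positivity
  rcases hP0.eq_or_lt with hPz | hPpos
  · rw [← hPz]
    exact hRHS0
  -- a positive payload needs at least two spheres, so `R ≥ 2 > 0`
  have hK2 : 2 ≤ K := by
    by_contra hK
    rw [not_le] at hK
    exact hPpos.ne' (collisionPayload_eq_zero_of_le_one (Nat.lt_succ_iff.mp hK) G ε γ a b)
  have hRpos : 0 < R := by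
    have hK' : (2 : ℝ) ≤ K := by exact_mod_cast hK2
    have h1 : 0 ≤ Real.sqrt ((K : ℝ) * E) := Real.sqrt_nonneg _
    have h2 : 0 ≤ (b - a) * E := by positivity
    have h3 : 0 ≤ ε * P := by positivity
    linarith
  -- the weights `w = κ |[v]|`, `κ = R / P`
  set κ : ℝ := R / P with hκ
  have hκpos : 0 < κ := div_pos hRpos hPpos
  set J : ℝ → Fin K → ℝ := fun t i => ‖(γ t i).2 - (leftLim γ t i).2‖ with hJ
  have hJ0 : ∀ t i, 0 ≤ J t i := fun t i => norm_nonneg _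
  have h := hC K ε hε γ hγ a b hab (fun t i => κ * J t i) fun t i =>
    mul_nonneg hκpos.le (hJ0 t i)
  -- the payload as the sum of the node jumps
  have hPJ : P = ∑ᶠ t ∈ collisionTimes G ε γ ∩ Icc a b, ∑ i, J t i := rfl
  have hterm : ∀ t i, (κ * J t i) ^ ((2 : ℝ) / 3) * ‖(γ t i).2 - (leftLim γ t i).2‖ ^ ((1 : ℝ) / 3) =
      κ ^ ((2 : ℝ) / 3) * J t i := by
    intro t i
    change (κ * J t i) ^ ((2 : ℝ) / 3) * J t i ^ ((1 : ℝ) / 3) = κ ^ ((2 : ℝ) / 3) * J t i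
    rw [Real.mul_rpow hκpos.le (hJ0 t i), mul_assoc,
      ← Real.rpow_add_of_nonneg (hJ0 t i) (by norm_num) (by norm_num),
      show (2 : ℝ) / 3 + 1 / 3 = 1 by norm_num, Real.rpow_one]
  have hL : (∑ᶠ t ∈ collisionTimes G ε γ ∩ Icc a b,
      ∑ i, (κ * J t i) ^ ((2 : ℝ) / 3) * ‖(γ t i).2 - (leftLim γ t i).2‖ ^ ((1 : ℝ) / 3)) =
      κ ^ ((2 : ℝ) / 3) * P := by
    simp_rw [hterm, ← Finset.mul_sum]
    rw [← mul_finsum_mem, hPJ]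
  have hW : (∑ᶠ t ∈ collisionTimes G ε γ ∩ Icc a b, ∑ i, κ * J t i) = κ * P := by
    simp_rw [← Finset.mul_sum]
    rw [← mul_finsum_mem, hPJ]
  have hκP : κ * P = R := div_mul_cancel₀ R hPpos.ne'
  rw [hL, hW, hκP] at h
  -- h : κ ^ (2/3) * P ≤ C * (R + R) ^ (4/3)
  have hLpos : 0 < κ ^ ((2 : ℝ) / 3) * P := mul_pos (Real.rpow_pos_of_pos hκpos _) hPpos
  have hCpos : 0 < C := by
    by_contra hC0
    rw [not_lt] at hC0
    have : C * (R + R) ^ ((4 : ℝ) / 3) ≤ 0 :=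
      mul_nonpos_of_nonpos_of_nonneg hC0 (Real.rpow_nonneg (by positivity) _)
    linarith
  rw [max_eq_left hCpos.le]
  -- cube both sides
  have h3 := pow_le_pow_left₀ hLpos.le h 3
  have e1 : (κ ^ ((2 : ℝ) / 3) * P) ^ 3 = κ ^ 2 * P ^ 3 := by
    rw [mul_pow, ← Real.rpow_natCast (κ ^ ((2 : ℝ) / 3)) 3, ← Real.rpow_mul hκpos.le,
      show (2 : ℝ) / 3 * ((3 : ℕ) : ℝ) = ((2 : ℕ) : ℝ) by norm_num, Real.rpow_natCast]
  have e2 : (C * (R + R) ^ ((4 : ℝ) / 3)) ^ 3 = 16 * C ^ 3 * R ^ 4 := by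
    rw [mul_pow, ← Real.rpow_natCast ((R + R) ^ ((4 : ℝ) / 3)) 3,
      ← Real.rpow_mul (by positivity : (0 : ℝ) ≤ R + R),
      show (4 : ℝ) / 3 * ((3 : ℕ) : ℝ) = ((4 : ℕ) : ℝ) by norm_num, Real.rpow_natCast]
    ring
  rw [e1, e2, hκ, div_pow] at h3
  -- h3 : R ^ 2 / P ^ 2 * P ^ 3 ≤ 16 * C ^ 3 * R ^ 4, i.e. R² P ≤ 16 C³ R⁴
  have h4 : R ^ 2 * P ≤ R ^ 2 * (16 * C ^ 3 * R ^ 2) := by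
    have hPne : P ≠ 0 := hPpos.ne'
    have : R ^ 2 / P ^ 2 * P ^ 3 = R ^ 2 * P := by
      field_simp
    rw [this] at h3
    linarith
  exact le_of_mul_le_mul_left h4 (by positivity)

/-- **`SerrePeriodicPayloadBound` from the weighted node inequality**: the output of compensated
integrability with determinantal masses for the corrected billiard tensor (Serre 2024 (14) with
(15)–(17)) implies Serre's periodic payload bound, by the optimisation over the node weights
(`inhomogeneous_of_nodeWeights`) followed by the scaling-and-absorption step
(`serrePeriodicPayloadBound_of_inhomogeneous`). [cite: Serre2024, §5 pp. 1438–1440] -/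
theorem serrePeriodicPayloadBound_of_nodeWeights
    (h14 : ∃ C : ℝ, ∀ (K : ℕ) (ε : ℝ), 0 < ε →
      ∀ γ : ℝ → Config K (Fin 3) T3, IsHardSphereTrajectory (Torus.geometry (Fin 3)) ε K γ →
        ∀ a b : ℝ, a ≤ b → ∀ w : ℝ → Fin K → ℝ, (∀ t i, 0 ≤ w t i) →
          (∑ᶠ t ∈ collisionTimes (Torus.geometry (Fin 3)) ε γ ∩ Icc a b,
              ∑ i, w t i ^ ((2 : ℝ) / 3) * ‖(γ t i).2 - (leftLim γ t i).2‖ ^ ((1 : ℝ) / 3)) ≤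
            C * ((K : ℝ) + Real.sqrt ((K : ℝ) * configEnergy (γ a)) +
              (b - a) * configEnergy (γ a) +
              ε * collisionPayload (Torus.geometry (Fin 3)) ε γ a b +
              ∑ᶠ t ∈ collisionTimes (Torus.geometry (Fin 3)) ε γ ∩ Icc a b, ∑ i, w t i) ^
                ((4 : ℝ) / 3)) :
    SerrePeriodicPayloadBound :=
  serrePeriodicPayloadBound_of_inhomogeneous (inhomogeneous_of_nodeWeights h14)

end Literature.MathematicalPhysics.KineticTheory

end
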